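import Literature.Computability.Complexity.IWReconstructionCase2
import Literature.Computability.Complexity.UniformDerandomizationRSRBridge
import Literature.Computability.Complexity.TVCorrector
import HarnessLib

/-!
# IW98 Case 2, closing: `impagliazzoWigderson1998_samplable` from the corrector machine, and
# `impagliazzoWigderson1998_samplable_holds`

Literature / complexity — derandomization under a uniform assumption (Impagliazzo–Wigderson 1998,
Thm. 5 = van Melkebeek Thm. 6.2.1); sequel of `IWReconstructionCase2.lean`, whose
`impagliazzoWigderson1998_samplable_of_LTV` leaves exactly one hypothesis: the random self-reduction of
Trevisan–Vadhan's `F` as polynomial-time post-processing of approximating descriptions (IW98 Def. 5,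
`C^{F,1−ρ} → C^F`, success `1 − 1/a`). The COUNTING of that self-reduction is in the tree
(`TVSelfCorrect.lean` … `TVSelfCorrectCoins.lean`: `QBFUniv.uniformProb_majCorrected_ne_le` — over uniform
coins the `8·2a`-fold corrected majority of an approximate description is `F` on all of `{0,1}^{h n i}`
except with probability `≤ 1/(2a)`), and `UniformDerandomizationRSRBridge.lean` isolated the MACHINE
content of the corrector as two equations on an evaluator `Ev'` (`hspec`: at canonical lengths `Ev'`
reads `⟨⟨d, ⟨1ᵃ, coins⟩⟩, w⟩` as that corrected majority; `hspec0`: off the canonical lengths it answers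
`0`, where `F = 0`). This file discharges the hypothesis of `…_of_LTV` from those two equations:

* `IWGen2.rsr_accuracy_le` — the accuracy polynomial: `128 · blk n · (Dn n + 1)² ≤ 4608 (h n i + 1)⁶`,
  so `2 / pD ≤ rsrRho` with `pD = 4608 (X + 1)⁶`;
* **`impagliazzoWigderson1998_samplable_of_corrector`** (and the printed twin
  `impagliazzoWigderson1998_of_corrector`) — if for every `Ev ∈ FP` there is an `Ev' ∈ FP` satisfying the
  two equations, then `impagliazzoWigderson1998_samplable`: the post-processing is the repackaging
  `⟨d, ⟨1ᵐ, ⟨1ᵃ, u⟩⟩⟩ ↦ ⟨d, ⟨1ᵃ, u⟩⟩`, the coins are `coinPoly (m + a)`, canonical lengths use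
  `uniformProb_majCorrected_ne_le`, the others are exact for free.

The `FP` construction of such an `Ev'` (field arithmetic of `GF(2^{blk n})` along random lines, plurality,
majority — TV07 Lemma 3.5's "well-known self-corrector for multivariate polynomials" as a machine) is
`TVCorrector.lean` (`TVCorr.exists_corrector`); the second module docstring below closes the fact.

Everything is proved; no definitions, no named facts.

## References

* [VanMelkebeek2000] D. van Melkebeek, *Randomness and Completeness in Computational Complexity*,
  LNCS 1950, Thm. 6.2.1 (p. 142).
* [ImpagliazzoWigderson2001] R. Impagliazzo, A. Wigderson, JCSS 63 (2001), Thm. 5, §2.2 Defs. 3–5.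
* [TrevisanVadhan2007] L. Trevisan, S. Vadhan, Comput. Complexity 16 (2007), Lemma 3.5, Thm. 3.9, Thm. 4.3.
-/

noncomputable section

namespace Literature.Computability.Complexity

open _root_.Computability Polynomial Finset Brick QBFUniv IWUniform

open scoped Classical

namespace IWGen2

/-- **The accuracy polynomial.** `2 · (64 · blk n · (Dn n + 1)²) ≤ 4608 (h n i + 1)⁶`
(`Dn n + 1 ≤ 3 (ptLen n + 1)²`, `blk n ≤ Dn n + 2`, `ptLen n ≤ h n i`). [folklore] -/
theorem rsr_accuracy_le (n i : ℕ) :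
    2 * (64 * blk n * (Dn n + 1) ^ 2) ≤ (4608 * (X + 1) ^ 6 : Polynomial ℕ).eval (h n i) := by
  have hpt : ptLen n ≤ h n i := by rw [h]; omega
  have hD : Dn n + 1 ≤ 3 * (ptLen n + 1) ^ 2 := by have := Dn_succ_le n; omega
  have hblk : blk n ≤ Dn n + 2 := by
    show Nat.log 2 (Dn n + 1) + 1 ≤ Dn n + 2
    have := Nat.log_le_self 2 (Dn n + 1)
    omega
  simp only [eval_mul, eval_pow, eval_add, eval_X, eval_one, eval_ofNat]
  have hD' : Dn n + 1 ≤ 3 * (h n i + 1) ^ 2 :=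
    hD.trans (Nat.mul_le_mul_left _ (Nat.pow_le_pow_left (by omega) 2))
  have hb' : blk n ≤ 4 * (h n i + 1) ^ 2 := by nlinarith
  calc 2 * (64 * blk n * (Dn n + 1) ^ 2) = 128 * blk n * (Dn n + 1) ^ 2 := by ring
    _ ≤ 128 * (4 * (h n i + 1) ^ 2) * (3 * (h n i + 1) ^ 2) ^ 2 := by gcongr
    _ = 4608 * (h n i + 1) ^ 6 := by ring

/-- **`impagliazzoWigderson1998_samplable` from the corrector machine.** If every polynomial-time
evaluator `Ev` has a polynomial-time `Ev'` reading `⟨⟨d, ⟨1ᵃ, c⟩⟩, w⟩` at a canonical length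
`|w| = h n i` (with `|c| ≥ coinsLen n i a`) as the `8·2a`-fold corrected majority of `y ↦ (Ev ⟨d, y⟩ = 1)`
with the trials decoded from `c`, and answering `0` off the canonical lengths, then van Melkebeek's
Thm. 6.2.1 holds. [cite: VanMelkebeek2000, Thm. 6.2.1 (p. 142)] [cite: ImpagliazzoWigderson2001, Thm. 5 and Def. 5]
[cite: TrevisanVadhan2007, Lemma 3.5 and Thm. 4.3] -/
theorem _root_.Literature.Computability.Complexity.impagliazzoWigderson1998_samplable_of_corrector
    (hmach : ∀ Ev : List Bool → List Bool, Ev ∈ FP → ∃ Ev' : List Bool → List Bool, Ev' ∈ FP ∧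
      (∀ (n i : ℕ), i ≤ mlen n → ∀ (d : List Bool) (a : ℕ) (c w : List Bool), w.length = h n i →
        coinsLen n i a ≤ c.length →
        Ev' (boolPair (boolPair d (boolPair (ones a) c)) w) =
          [majCorrected (descFn Ev d) n (decodeTrials n i (trialsOf (2 * a)) c) w]) ∧
      (∀ (d' w : List Bool), ¬ (ptLen (nOf w.length) + blk (nOf w.length) ≤ w.length - pre (nOf w.length)) →
        Ev' (boolPair d' w) = [false])) :
    impagliazzoWigderson1998_samplable := by
  refine impagliazzoWigderson1998_samplable_of_LTV (pD := 4608 * (X + 1) ^ 6) (fun m => ?_) fun Ev hEv => ?_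
  · simp only [eval_mul, eval_pow, eval_add, eval_X, eval_one, eval_ofNat]
    have : 1 ≤ (m + 1) ^ 6 := Nat.one_le_pow _ _ (Nat.succ_pos _)
    omega
  obtain ⟨Ev', hEv', hspec, hspec0⟩ := hmach Ev hEv
  refine ⟨Ev', fanoutFn fstF (sndF ∘ sndF), hEv', fanoutFn_mem_FP fstF_mem_FP (comp_mem_FP sndF_mem_FP sndF_mem_FP),
    coinPoly, 0, fun m _ a ha d hd => ?_⟩
  -- the repackaged description `⟨d, ⟨1ᵃ, u⟩⟩` and the function `F`
  have hcorr : ∀ u : List Bool, fanoutFn fstF (sndF ∘ sndF)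
      (boolPair d (boolPair (unaryEncodeNat m) (boolPair (unaryEncodeNat a) u))) = boolPair d (boolPair (ones a) u) := by
    intro u
    rw [fanoutFn_apply, fstF_boolPair, Function.comp_apply, sndF_boolPair, sndF_boolPair, ← CodeFP.unE_eq_ones]
  have hF : hardFn QBFUniv.LTV = FB := funext fun w => TVChk.boolIndicator_LTV w
  simp only [hcorr]
  rw [hF] at hd ⊢
  have ha' : (1 : ℝ) ≤ a := by exact_mod_cast ha
  by_cases hc : ptLen (nOf m) + blk (nOf m) ≤ m - pre (nOf m)
  swap
  · -- non-canonical length: `F ≡ 0` there and `Ev'` answers `0`, every coin string is good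
    have hall : uniformProb (coinPoly.eval (m + a)) {u | boolPair d (boolPair (ones a) u) ∈ Bootstrap.circuitsFor Ev' FB m} = 1 := by
      rw [← uniformProb_univ (coinPoly.eval (m + a))]
      congr 1
      ext u
      simp only [Set.mem_setOf_eq, Set.mem_univ, iff_true]
      intro y hy
      have hc' : ¬ (ptLen (nOf y.length) + blk (nOf y.length) ≤ y.length - pre (nOf y.length)) := by rwa [hy]
      rw [hspec0 _ y hc', FB, if_neg hc']
    rw [hall]
    have : (0 : ℝ) ≤ 1 / a := by positivity
    linarith
  · -- canonical length `m = h n i`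
    have hk : h (nOf m) (iOf m) = m := h_nOf_iOf_eq hc
    have hi : iOf m ≤ mlen (nOf m) := iOf_le m
    have hacc : 2 * (64 * blk (nOf m) * (Dn (nOf m) + 1) ^ 2) ≤ (4608 * (X + 1) ^ 6 : Polynomial ℕ).eval m := by
      have h1 := rsr_accuracy_le (nOf m) (iOf m)
      rwa [hk] at h1
    have hbpos : 0 < 64 * blk (nOf m) * (Dn (nOf m) + 1) ^ 2 := by have := blk_pos (nOf m); positivity
    have hppos : 0 < (4608 * (X + 1) ^ 6 : Polynomial ℕ).eval m := by
      simp only [eval_mul, eval_pow, eval_add, eval_X, eval_one, eval_ofNat]; positivity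
    have hρ' : (2 : ℝ) / (((4608 * (X + 1) ^ 6 : Polynomial ℕ).eval m : ℕ) : ℝ) ≤ rsrRho m := by
      rw [rsrRho, div_le_div_iff₀ (by exact_mod_cast hppos) (by exact_mod_cast hbpos), one_mul]
      exact_mod_cast hacc
    have hd' : d ∈ approxCircuits Ev FB rsrRho (h (nOf m) (iOf m)) := by
      rw [hk]
      exact approxCircuits_mono Ev FB hρ' hd
    have hρ : rsrRho (h (nOf m) (iOf m)) ≤ 1 / ((64 * blk (nOf m) * (Dn (nOf m) + 1) ^ 2 : ℕ) : ℝ) := by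
      rw [rsrRho, nOf_h]
    have hL : coinsLen (nOf m) (iOf m) a ≤ coinPoly.eval (m + a) := by
      have h1 := coinsLen_le (nOf m) (iOf m) a
      rwa [hk] at h1
    have hbad := QBFUniv.uniformProb_majCorrected_ne_le hi hd' hρ ha hL
    -- the good coin strings give exact circuits
    have himp : ∀ u : List Bool, u.length = coinPoly.eval (m + a) →
        u ∈ {u : List Bool | boolPair d (boolPair (ones a) u) ∈ Bootstrap.circuitsFor Ev' FB m}ᶜ →
        u ∈ {u : List Bool | ∃ w : List Bool, w.length = h (nOf m) (iOf m) ∧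
          majCorrected (descFn Ev d) (nOf m) (decodeTrials (nOf m) (iOf m) (trialsOf (2 * a)) u) w ≠ FB w} ∨
        u ∈ (∅ : Set (List Bool)) := by
      intro u hu huS
      left
      by_contra hno
      apply huS
      simp only [Set.mem_setOf_eq]
      intro y hy
      have hy' : y.length = h (nOf m) (iOf m) := by rw [hk, hy]
      have hlen : coinsLen (nOf m) (iOf m) a ≤ u.length := by rw [hu]; exact hL
      rw [hspec (nOf m) (iOf m) hi d a u y hy' hlen]
      by_contra hne
      exact hno ⟨y, hy', fun heq => hne (by rw [heq])⟩
    have h1 := uniformProb_le_add_of_imp himp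
    rw [uniformProb_empty, add_zero, uniformProb_compl] at h1
    have h2 : 1 / (2 * a : ℝ) ≤ 1 / a := by
      rw [div_le_div_iff₀ (by positivity) (by positivity)]; linarith
    linarith

/-- The same for the printed-class rendering `impagliazzoWigderson1998`, through the equivalence
`impagliazzoWigderson1998_of_samplable` (`UniformDerandomizationRandAlg.lean`).
[cite: VanMelkebeek2000, Thm. 6.2.1 (p. 142)] [cite: ImpagliazzoWigderson2001, Thm. 5] -/
theorem _root_.Literature.Computability.Complexity.impagliazzoWigderson1998_of_corrector
    (hmach : ∀ Ev : List Bool → List Bool, Ev ∈ FP → ∃ Ev' : List Bool → List Bool, Ev' ∈ FP ∧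
      (∀ (n i : ℕ), i ≤ mlen n → ∀ (d : List Bool) (a : ℕ) (c w : List Bool), w.length = h n i →
        coinsLen n i a ≤ c.length →
        Ev' (boolPair (boolPair d (boolPair (ones a) c)) w) =
          [majCorrected (descFn Ev d) n (decodeTrials n i (trialsOf (2 * a)) c) w]) ∧
      (∀ (d' w : List Bool), ¬ (ptLen (nOf w.length) + blk (nOf w.length) ≤ w.length - pre (nOf w.length)) →
        Ev' (boolPair d' w) = [false])) :
    impagliazzoWigderson1998 :=
  impagliazzoWigderson1998_of_samplable (impagliazzoWigderson1998_samplable_of_corrector hmach)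

end IWGen2

end Literature.Computability.Complexity

end


/-!
# `impagliazzoWigderson1998_samplable_holds`: van Melkebeek's Thm. 6.2.1 (Impagliazzo–Wigderson 1998,
# Thm. 5) is a theorem of the tree

Literature / complexity — derandomization under a uniform assumption. The named fact
`impagliazzoWigderson1998_samplable` (`UniformDerandomization.lean`: if `BPP ≠ EXP` then every `BPP`
language is decided, for every `ε > 0`, by a `DTIME(2^{n^ε})` language on all but a `1/n^d` fraction of
the inputs drawn from any polynomial-time samplable ensemble, for infinitely many lengths) is discharged
here, closing the chain

`IWReconstructionWeakStage` → `IWReconstructionCase2` (`…_of_LTV`) → `…_of_corrector` (above) ←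
`TVCorrector` (`TVCorr.exists_corrector`),

on top of the tree's Case 1 (`BFNWCase1`), the endgame (`UniformDerandomizationEndgame`), Lemma 16
(`IWBootstrapping`), Trevisan–Vadhan's `F` (`TVFunction`, `TVHardness`, `TVDsrMachine`, `TVLanguageEXP`,
`TVSelfCorrect*`) and the derandomization half (`UniformDerandomizationProofs`). The printed-class twin
`impagliazzoWigderson1998` (`UniformDerandomizationRandAlg.lean`) follows by the equivalence of the two
renderings (`UniformDerandomizationEquiv.lean`).

* **`impagliazzoWigderson1998_samplable_holds`**, **`impagliazzoWigderson1998_holds`**.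

## References

* [VanMelkebeek2000] D. van Melkebeek, *Randomness and Completeness in Computational Complexity*,
  LNCS 1950, Springer 2000, Thm. 6.2.1 (p. 142).
* [ImpagliazzoWigderson2001] R. Impagliazzo, A. Wigderson, *Randomness vs time: derandomization under a
  uniform assumption*, JCSS 63 (2001), Thm. 5.
* [TrevisanVadhan2007] L. Trevisan, S. Vadhan, Comput. Complexity 16 (2007), §3 and Thm. 4.3.
-/

namespace Literature.Computability.Complexity

/-- **van Melkebeek, Thm. 6.2.1 (Impagliazzo–Wigderson 1998, Thm. 5), samplable-ensemble rendering.**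
[cite: VanMelkebeek2000, Thm. 6.2.1 (p. 142)] [cite: ImpagliazzoWigderson2001, Thm. 5] [cite: TrevisanVadhan2007, Thm. 3.9 and Thm. 4.3] -/
theorem impagliazzoWigderson1998_samplable_holds : impagliazzoWigderson1998_samplable :=
  impagliazzoWigderson1998_samplable_of_corrector fun _ hEv => TVCorr.exists_corrector hEv

/-- **The printed-class rendering** `impagliazzoWigderson1998` (samplers with exact polynomial coins).
[cite: VanMelkebeek2000, Thm. 6.2.1 (p. 142)] [cite: ImpagliazzoWigderson2001, Thm. 5] -/
theorem impagliazzoWigderson1998_holds : impagliazzoWigderson1998 :=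
  impagliazzoWigderson1998_of_corrector fun _ hEv => TVCorr.exists_corrector hEv

end Literature.Computability.Complexity
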